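import Summits.ResolutionOfSingularities.ResolutionOfSingularities.Theorems.FrobeniusLadderFInjectiveMacaulayficationFDStorey1FanChecks
import Summits.ResolutionOfSingularities.ResolutionOfSingularities.Theorems.FrobeniusLadderFInjectiveMacaulayficationFDStorey1CoverChecks
import Summits.ResolutionOfSingularities.ResolutionOfSingularities.Theorems.FrobeniusLadderFInjectiveMacaulayficationFDStorey1PolyChecks
import Summits.ResolutionOfSingularities.ResolutionOfSingularities.Theorems.FrobeniusLadderFInjectiveMacaulayficationKLocCell
import Summits.ResolutionOfSingularities.ResolutionOfSingularities.Theorems.FrobeniusLadderFInjectiveMacaulayficationKLocCellOff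
import Summits.ResolutionOfSingularities.ResolutionOfSingularities.Theorems.FrobeniusLadderFInjectiveMacaulayficationCIPolyKit
import Summits.ResolutionOfSingularities.ResolutionOfSingularities.Theorems.FrobeniusLadderFInjectiveMacaulayficationNotDvdOfSupport
import Summits.ResolutionOfSingularities.ResolutionOfSingularities.Theorems.FrobeniusLadderFInjectiveMacaulayficationPConeFedderData
import HarnessLib

/-!
# BED D STOREY 1 — THE BINDERS: fan side (`hV hgen hge hcov hm haA hv hprimAJ`, `span_A_eq_floor_mul_K`) and polynomial side (`hθF₀ hX hg0`, the per-chart naive-quotient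
# clauses `honStd` on the 325 whole-chart charts and `honOff` on the two P-charts) of the monomial blow-up certificate of `f_D = z⁴+x⁵z+x⁶+y³+u³+t⁷` (char 2) along `𝔪·K`
# (crux `FInjectiveMacaulayfication` stmt-ResolutionOfSingularities-15315, chain w45a; (W-TD) BED D storey 1 (D-1), res-L1-w45a-plan-1 R21.15 (2)(D-1) / R21.16 (2) / R21.18 (4); seat
# res-L1-w45a-stub-2 g10; data = `FDStorey1{FanTables,PolyTables,CellTables,CoverRecords0–4}`, kernel checks = `FDStorey1{FanChecks,CoverChecks,PolyChecks}`)

Support file for crux stmt-ResolutionOfSingularities-15315 (`FrobeniusLadder.FInjectiveMacaulayfication`), chain w45a.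
[OURS · L1 W4.5a] — NOT a statement of any manuscript; AI-written, weaker than expert review.

Everything is read off ONE-`decide` kernel checks by the soundness theorems of res-L1-w45a-stub-4's `FanCheckSound*` and this seat's `FanCheckMulti` / `FanCheckProduct` /
`FanCheckChunks`; the centre's generator set is `A := genSet 5 AL2` with `AL2 := prodGens 5 KL2` (so `span (x^A) = span (range x̄ⱼ) * span (x^K)` modulo ANY `F`, §2), the chart
matrices are `Vq c` (`= chartV 5 RAYS CL 327 c`), the vertices/neighbours `chartM/chartA 5 AL2 CL 327`, the shifts `dq c`, the strict transforms `g_c = KLocCellKit.evalL k (G c)`.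
§3: on the 325 charts `c ∉ {266, 277}` the naive-quotient clause `honStd` holds at EVERY maximal ideal over the centre (`KLocCell.honQuot_of_kLocCells` on the whole-chart
cell); on the P-charts 266/277 `honOff` holds at every maximal ideal over the centre NOT containing all of `Y₀, Y₁, Y₂+1, Y₃, Y₄` (`KLocCellOff.honQuot_of_kLocCells_off'`), i.e.
off the non-F-pure point `P = (0,0,1,0,0)`. No definitions, no named facts. [folklore; cite: Fedder1983, Thm. 1.12; CoxLittleSchenck2011, §2.3]
-/

-- single-problem summit: the doubled namespace component is forced
set_option linter.dupNamespace false

noncomputable section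

namespace Summit.ResolutionOfSingularities.ResolutionOfSingularities.Theorems.FInjectiveMacaulayfication.FDStorey1Fan

open MvPolynomial
open Summit.ResolutionOfSingularities.ResolutionOfSingularities.Theorems.FInjectiveMacaulayfication
open FanCheckKit FanCheckSound

/-! ## §1 Fan-side binders -/

/-- Every generator of `K` has length 5. -/
theorem klen : ∀ b ∈ KL2.flatten, b.length = 5 := by
  intro b hb
  obtain ⟨ch, hch, hbch⟩ := List.mem_flatten.mp hb
  have h := List.all_eq_true.mp check_klen.1 ch hch
  exact allLen_spec h b hbch

/-- ★ THE CENTRE BINDERS: every generator involves a variable (`hprimAJ.1 = hAJ`), and pure powers of all variables lie in `A` (`hprimAJ.2 = hprim`; the centre is `𝔪`-primary). -/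
theorem hprimAJ : (∀ e ∈ genSet 5 AL2, ∃ j ∈ (Finset.univ : Finset (Fin 5)), 0 < e j) ∧
    (∀ j ∈ (Finset.univ : Finset (Fin 5)), ∃ N : ℕ, Finsupp.single j N ∈ genSet 5 AL2) :=
  ⟨hAJ_of_check (n := 5) (r := 1) (AL2 := AL2) (RAYS := RAYS) (CL := CL) shapes.1 check_hAJ.1,
    hprim_of_check (n := 5) (r := 1) (AL2 := AL2) (RAYS := RAYS) (CL := CL) (PJ := PJ) shapes.1 check_hprim.1⟩

/-- The vertices are generators. -/
theorem hm : ∀ c : Fin 327, chartM 5 AL2 CL 327 c ∈ genSet 5 AL2 := hm_of_shapes 5 1 AL2 RAYS CL 327 shapes.1 tlen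

/-- The neighbours are generators. -/
theorem haA : ∀ (c : Fin 327) (i : Fin 5), chartA 5 AL2 CL 327 c i ∈ genSet 5 AL2 := haA_of_shapes 5 1 AL2 RAYS CL 327 shapes.1 tlen

/-- The chart matrices are unimodular. -/
theorem hV : ∀ c : Fin 327, IsUnit (((Vq c).map (Nat.cast : ℕ → ℤ)).det) := fun c => by
  rw [hVq c]; exact hV_of_check 5 1 AL2 RAYS CL 327 VinvTL shapes.1 tlen check_det.1 c

/-- (hgen) `V_c a_c i = V_c m_c + e_i`. -/
theorem hgen : ∀ (c : Fin 327) (i : Fin 5), (Finsupp.equivFunOnFinite.symm ((Vq c).mulVec ⇑(chartA 5 AL2 CL 327 c i)) : Fin 5 →₀ ℕ) =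
    Finsupp.equivFunOnFinite.symm ((Vq c).mulVec ⇑(chartM 5 AL2 CL 327 c)) + Finsupp.single i 1 := fun c => by
  rw [hVq c]; exact hgen_of_check 5 1 AL2 RAYS CL 327 shapes.1 tlen check_hgen.1 c

/-- (h≥) `m_c` minimises every row of `V_c` over `A`. -/
theorem hge : ∀ (c : Fin 327), ∀ e ∈ genSet 5 AL2, (Finsupp.equivFunOnFinite.symm ((Vq c).mulVec ⇑(chartM 5 AL2 CL 327 c)) : Fin 5 →₀ ℕ) ≤
    Finsupp.equivFunOnFinite.symm ((Vq c).mulVec ⇑e) := fun c => by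
  rw [hVq c]; exact hge_of_check 5 1 AL2 RAYS CL 327 shapes.1 tlen check_hge.1 c

/-- `hcov`: the cover identities `(x^e)^K = x^(m c) · y`, `y ∈ I_A^(K-1)`, from the sparse multi-vertex records, block by block. -/
theorem hcov (k : Type) [Field k] : ∀ e ∈ genSet 5 AL2, ∃ (c : Fin 327) (K : ℕ), 1 ≤ K ∧
    ∃ y ∈ (Ideal.span ((fun b : Fin 5 →₀ ℕ => (MvPolynomial.monomial b (1 : k) : MvPolynomial (Fin 5) k)) '' (genSet 5 AL2 : Set (Fin 5 →₀ ℕ)))) ^ (K - 1),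
      (MvPolynomial.monomial e (1 : k) : MvPolynomial (Fin 5) k) ^ K = MvPolynomial.monomial (chartM 5 AL2 CL 327 c) 1 * y :=
  FanCheckChunks.hcov_of_blocks k KL2 MV2 RAYS CL 50 327 RLMB shapes.1 tlen check_mvbridge check_hcov

/-- `hv`: the vertex monomials lie in the image of `I_A` modulo any `(Fs)`. -/
theorem hv (k : Type) [Field k] {r' : ℕ} (Fs : Fin r' → MvPolynomial (Fin 5) k) (c : Fin 327) :
    Ideal.Quotient.mk (Ideal.span (Set.range Fs)) (monomial (chartM 5 AL2 CL 327 c) (1 : k)) ∈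
      Ideal.span ((fun e : Fin 5 →₀ ℕ => Ideal.Quotient.mk (Ideal.span (Set.range Fs)) (monomial e (1 : k))) '' (genSet 5 AL2 : Set (Fin 5 →₀ ℕ))) :=
  hv_of_shapes (n := 5) (r := 1) (AL2 := AL2) (RAYS := RAYS) (CL := CL) (t := 327) shapes.1 tlen Fs c

/-! ## §2 ★ The centre is the PRODUCT `𝔪·K` -/

/-- ★ **THE CERTIFIED CENTRE IS LITERALLY THE PRODUCT `𝔪·K`**: in `k[X]/F` (any `F`), `span (x^A) = span (range x̄ⱼ) * span (x^K)` with `K`'s generator set `genSet 5 KL2` —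
by `FanCheckProduct.span_genSet_prodGens` (the generator table `AL2` IS `prodGens 5 KL2`). [folklore; cite: CoxLittleSchenck2011, §2.3] -/
theorem span_A_eq_floor_mul_K (k : Type) [Field k] (F : Ideal (MvPolynomial (Fin 5) k)) :
    Ideal.span ((fun e : Fin 5 →₀ ℕ => Ideal.Quotient.mk F (monomial e (1 : k))) '' (genSet 5 AL2 : Set (Fin 5 →₀ ℕ))) =
      Ideal.span (Set.range fun j : Fin 5 => Ideal.Quotient.mk F (X j)) *
        Ideal.span ((fun e : Fin 5 →₀ ℕ => Ideal.Quotient.mk F (monomial e (1 : k))) '' (genSet 5 KL2 : Set (Fin 5 →₀ ℕ))) :=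
  FanCheckProduct.span_genSet_prodGens k F KL2 klen

/-- The pure powers `x_j^(N_j)` in `K`: `x^5327, y^3749, u^3749, t^6231, z^4655` — so `𝔪 ⊆ √K`, `K` is `𝔪`-primary. -/
theorem hKpow : (Pi.single 0 5327 : Fin 5 → ℕ) ∈ KL2.flatten.map (vecOf 5) ∧ (Pi.single 1 3749 : Fin 5 → ℕ) ∈ KL2.flatten.map (vecOf 5) ∧
    (Pi.single 2 3749 : Fin 5 → ℕ) ∈ KL2.flatten.map (vecOf 5) ∧ (Pi.single 3 6231 : Fin 5 → ℕ) ∈ KL2.flatten.map (vecOf 5) ∧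
    (Pi.single 4 4655 : Fin 5 → ℕ) ∈ KL2.flatten.map (vecOf 5) := by
  decide +kernel

/-- Pure powers of all five variables lie in `span (x^K)` modulo any `F`: `x̄ⱼ ∈ √K`. [folklore] -/
theorem mk_X_mem_radical_span_K (k : Type) [Field k] (F : Ideal (MvPolynomial (Fin 5) k)) (j : Fin 5) :
    Ideal.Quotient.mk F (X j) ∈ (Ideal.span ((fun e : Fin 5 →₀ ℕ => Ideal.Quotient.mk F (monomial e (1 : k))) '' (genSet 5 KL2 : Set (Fin 5 →₀ ℕ)))).radical := by
  have key : ∀ (j : Fin 5) (N : ℕ), (Pi.single j N : Fin 5 → ℕ) ∈ KL2.flatten.map (vecOf 5) →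
      Ideal.Quotient.mk F (X j : MvPolynomial (Fin 5) k) ∈
        (Ideal.span ((fun e : Fin 5 →₀ ℕ => Ideal.Quotient.mk F (monomial e (1 : k))) '' (genSet 5 KL2 : Set (Fin 5 →₀ ℕ)))).radical := by
    intro j N hN
    obtain ⟨l, hl, hlj⟩ := List.mem_map.mp hN
    refine ⟨N, ?_⟩
    rw [← map_pow, X_pow_eq_monomial]
    have he : expOf 5 l = Finsupp.single j N :=
      DFunLike.coe_injective (by rw [coe_expOf, hlj, Finsupp.single_eq_pi_single])
    rw [← he]
    exact Ideal.subset_span ⟨_, Finset.mem_coe.mpr (expOf_mem_genSet hl), rfl⟩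
  obtain ⟨h0, h1, h2, h3, h4⟩ := hKpow
  fin_cases j
  exacts [key 0 _ h0, key 1 _ h1, key 2 _ h2, key 3 _ h3, key 4 _ h4]

/-! ## §3 Polynomial-side binders -/

/-- The `θ`-factorisation witnesses in the `CIPolyKit.theta_evalL` shape. -/
theorem hθ_raw (c : Fin 327) : List.Forall₂ (fun t t' : ℤ × (Fin 5 → ℕ) => t.1 = t'.1 ∧ (Vq c).mulVec t.2 = dq c + t'.2) FL (G c) := by
  refine (hθ_rawq c).imp fun {t t'} h => ⟨h.1, funext fun i => ?_⟩
  rw [Pi.add_apply, ← h.2 i]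
  simp [Matrix.mulVec, dotProduct, Fin.sum_univ_five]

/-- `f_D` is the value of the term list `FL`. [folklore] -/
theorem f_eq_evalL (k : Type) [Field k] :
    (X 4 ^ 4 + X 0 ^ 5 * X 4 + X 0 ^ 6 + X 1 ^ 3 + X 2 ^ 3 + X 3 ^ 7 : MvPolynomial (Fin 5) k) = KLocCellKit.evalL k FL := by
  simp only [KLocCellKit.evalL, FL, List.map_cons, List.map_nil, List.sum_cons, List.sum_nil, Int.cast_one,
    PConeFedderData.monomial_five]
  ring

/-- **`hθF₀`**: `θ_(V c) f_D = Y^(d c) · g_c` with `g_c = KLocCellKit.evalL k (G c)`. -/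
theorem hθF₀ (k : Type) [Field k] (c : Fin 327) :
    aeval (fun j : Fin 5 => ∏ i : Fin 5, (X i : MvPolynomial (Fin 5) k) ^ Vq c i j) (X 4 ^ 4 + X 0 ^ 5 * X 4 + X 0 ^ 6 + X 1 ^ 3 + X 2 ^ 3 + X 3 ^ 7 : MvPolynomial (Fin 5) k) =
      monomial (Finsupp.equivFunOnFinite.symm (dq c)) (1 : k) * KLocCellKit.evalL k (G c) := by
  rw [f_eq_evalL]
  exact CIPolyKit.theta_evalL (Vq c) (dq c) FL (G c) (hθ_raw c)

/-- The shift `dq c` is the chart record's exceptional vector `d c 0`. -/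
theorem symm_dq (c : Fin 327) : Finsupp.equivFunOnFinite.symm (dq c) = chartD 5 1 CL 327 c 0 := by
  rw [hdq c]; rfl

/-- No variable divides a strict transform (`¬ Yᵢ ∣ g_c`). -/
theorem hX (k : Type) [Field k] [CharP k 2] (c : Fin 327) : ∀ i : Fin 5, ¬ (X i ∣ KLocCellKit.evalL k (G c)) := by
  unfold KLocCellKit.evalL
  exact NotDvdOfSupport.forall_not_X_dvd_evalL 2 (G c) (hX_raw c)

/-- The strict transforms are non-zero. -/
theorem hg0 (k : Type) [Field k] [CharP k 2] (c : Fin 327) : KLocCellKit.evalL k (G c) ≠ 0 :=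
  fun h => hX k c 0 (by rw [h]; exact dvd_zero _)

/-- ★ **THE NAIVE-QUOTIENT CLAUSE ON THE 325 WHOLE-CHART CHARTS** (`c ∉ {266, 277}`): at EVERY maximal ideal of `k[Y]/(g_c)` over the centre, the CI binder and the
Cohen–Macaulay + Frobenius-closed clause — `KLocCell.honQuot_of_kLocCells` on the whole-chart cofactor cell (`S = ∅` covers every zero pattern).
[folklore; cite: Fedder1983, Prop. 1.7 and Thm. 1.12] -/
theorem honStd (k : Type) [Field k] [CharP k 2] (c : Fin 327) (hc : c.val ≠ 266) (hc' : c.val ≠ 277) :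
    ∀ (Q' : Ideal (MvPolynomial (Fin 5) k ⧸ Ideal.span {KLocCellKit.evalL k (G c)})) [Q'.IsMaximal],
      (∀ j ∈ (Finset.univ : Finset (Fin 5)), Ideal.Quotient.mk (Ideal.span {KLocCellKit.evalL k (G c)})
        (aeval (fun j : Fin 5 => ∏ i : Fin 5, (X i : MvPolynomial (Fin 5) k) ^ Vq c i j) (X j : MvPolynomial (Fin 5) k)) ∈ Q') →
        (∀ i : Fin 5, (X i : MvPolynomial (Fin 5) k) ∈ Q'.comap (Ideal.Quotient.mk (Ideal.span {KLocCellKit.evalL k (G c)})) →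
          IsSMulRegular (Localization.AtPrime (Q'.comap (Ideal.Quotient.mk (Ideal.span {KLocCellKit.evalL k (G c)}))) ⧸
              (Ideal.span {KLocCellKit.evalL k (G c)}).map (algebraMap (MvPolynomial (Fin 5) k)
                (Localization.AtPrime (Q'.comap (Ideal.Quotient.mk (Ideal.span {KLocCellKit.evalL k (G c)}))))))
            (algebraMap (MvPolynomial (Fin 5) k)
              (Localization.AtPrime (Q'.comap (Ideal.Quotient.mk (Ideal.span {KLocCellKit.evalL k (G c)})))) (X i))) ∧
        ∀ dd : ℕ, ringKrullDim (Localization.AtPrime Q') = dd → ∀ s : Fin dd → Localization.AtPrime Q',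
          (Ideal.span (Set.range s)).radical.IsMaximal →
            RingTheory.Sequence.IsWeaklyRegular (Localization.AtPrime Q') (List.ofFn s) ∧
            ∀ y : Localization.AtPrime Q', (∃ e : ℕ, y ^ 2 ^ e ∈ Ideal.span
              ((fun z : Localization.AtPrime Q' => z ^ 2 ^ e) ''
                (Ideal.span (Set.range s) : Set (Localization.AtPrime Q')))) → y ∈ Ideal.span (Set.range s) := by
  haveI : Fact (Nat.Prime 2) := ⟨Nat.prime_two⟩
  exact KLocCell.honQuot_of_kLocCells 2 k 5 Finset.univ (Vq c) (KLocCellKit.evalL k (G c)) (hg0 k c) (hX k c)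
    ((CELLS c).map Prod.fst) (fun T _ => ⟨∅, hS_empty c hc hc', Finset.empty_subset T⟩)
    (KLocCellKit.klocCells_of_check k 2 (G c) (CELLS c) (hcheck c))

/-- ★ **THE NAIVE-QUOTIENT CLAUSE ON THE P-CHARTS 266 / 277, OFF `P`**: at every maximal ideal `Q'` of `k[Y]/(g_c)` over the centre which does NOT contain all of
`Y₀, Y₁, Y₂ + 1, Y₃, Y₄` (i.e. `Q' ≠ 𝔪_P`), the Cohen–Macaulay + Frobenius-closed clause — `KLocCellOff.honQuot_of_kLocCells_off'` on the plain `Y₂ = 0` cell and the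
OFF-cells. [folklore; cite: Fedder1983, Prop. 1.7 and Thm. 1.12] -/
theorem honOff (k : Type) [Field k] [CharP k 2] (c : Fin 327) (hc : c.val = 266 ∨ c.val = 277) :
    ∀ (Q' : Ideal (MvPolynomial (Fin 5) k ⧸ Ideal.span {KLocCellKit.evalL k (G c)})) [Q'.IsMaximal],
      (∀ j ∈ (Finset.univ : Finset (Fin 5)), Ideal.Quotient.mk (Ideal.span {KLocCellKit.evalL k (G c)})
        (aeval (fun j : Fin 5 => ∏ i : Fin 5, (X i : MvPolynomial (Fin 5) k) ^ Vq c i j) (X j : MvPolynomial (Fin 5) k)) ∈ Q') →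
      ¬ (Ideal.span {x | x ∈ HS.map (KLocCellKit.evalL k)}).map (Ideal.Quotient.mk (Ideal.span {KLocCellKit.evalL k (G c)})) ≤ Q' →
        ∀ dd : ℕ, ringKrullDim (Localization.AtPrime Q') = dd → ∀ s : Fin dd → Localization.AtPrime Q',
          (Ideal.span (Set.range s)).radical.IsMaximal →
            RingTheory.Sequence.IsWeaklyRegular (Localization.AtPrime Q') (List.ofFn s) ∧
            ∀ y : Localization.AtPrime Q', (∃ e : ℕ, y ^ 2 ^ e ∈ Ideal.span
              ((fun z : Localization.AtPrime Q' => z ^ 2 ^ e) ''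
                (Ideal.span (Set.range s) : Set (Localization.AtPrime Q')))) → y ∈ Ideal.span (Set.range s) := by
  haveI : Fact (Nat.Prime 2) := ⟨Nat.prime_two⟩
  -- the cell data of THIS chart: plain cells on `SS = (CELLS c).map fst = [{2}]`, off-cells `OFF c`
  have hdata : ∃ OFF : List (Finset (Fin 5) × List ((Fin 5 → ℕ) × List (ℤ × (Fin 5 → ℕ))) × (Fin 5 → List (ℤ × (Fin 5 → ℕ))) ×
      List (ℤ × (Fin 5 → ℕ)) × List (ℤ × (Fin 5 → ℕ)) × ℕ),
      KLocCellKit.checkKsOff 2 (G c) OFF = true ∧ (∀ S ∈ SSoff, ∀ H ∈ HS, ∃ r ∈ OFF, r.1 = S ∧ r.2.2.2.2.1 = H) ∧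
      (CELLS c).map Prod.fst = [({2} : Finset (Fin 5))] := by
    rcases hc with hc | hc
    · have : c = ⟨266, by decide⟩ := Fin.ext hc
      subst this
      exact ⟨OFF266, hcheckOff266, hOffCover266, hS_P.1⟩
    · have : c = ⟨277, by decide⟩ := Fin.ext hc
      subst this
      exact ⟨OFF277, hcheckOff277, hOffCover277, hS_P.2⟩
  obtain ⟨OFF, hchk, hcov, hSS⟩ := hdata
  intro Q' _ hθ hQ
  refine KLocCellOff.honQuot_of_kLocCells_off' 2 k 5 Finset.univ (Vq c) (KLocCellKit.evalL k (G c)) (hg0 k c) (hX k c)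
    ((CELLS c).map Prod.fst) SSoff (HS.map (KLocCellKit.evalL k)) ?_ (KLocCellKit.klocCells_of_check k 2 (G c) (CELLS c) (hcheck c))
    (KLocCellKit.offCells_of_check k 2 (G c) SSoff HS OFF hchk hcov) Q' hθ hQ
  intro T hT
  rw [hSS]
  exact hSScovP c hc T hT

end Summit.ResolutionOfSingularities.ResolutionOfSingularities.Theorems.FInjectiveMacaulayfication.FDStorey1Fan

end
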